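import Summits.BirchSwinnertonDyer.BirchSwinnertonDyer.Theses.ShaPrimaryTransfer
import Literature.NumberTheory.EllipticCurves.KubertTate289ShaTwo
import HarnessLib

/-!
# BirchSwinnertonDyer / ShaPrimaryTransfer — crux `FiniteShaComponentTransfer` (stmt-BirchSwinnertonDyer-22356):
# THE CUBIC `2`-DESCENT DOOR — `t₂(E_{28/9}) = 0` at rank `2` for a curve WITHOUT rational `2`-torsion,
# by a complete `2`-isogeny descent over its cubic `2`-division field and descent of the corank to `ℚ`

Helper file of prover seat `bsd-line-spt-p1` g27 (`--supports stmt-22356 --as helper`). THEOREMS ONLY (no definition, no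
named fact, no `sorry`, no instance); imports the route file and Literature only (theses-cone rule). **BSD is NOT proved by
this file; T (`FiniteShaComponentTransfer`: `t_p(E) = 0 → t_q(E) = 0` for every elliptic `E/ℚ`) is unchanged and
conjecture-grade at corank ≥ 2.** What is new is a DOOR AT `2` for a rank-`2` curve with `E(ℚ)[2] = 0`, where no
`2`-isogeny descent over `ℚ` exists; the mathematics is in Literature (`KubertTate289ShaTwo.shaCorank_two_eq_zero`):

`E = E_{28/9} = kubertTateFive 28 9 = [-19, -252, -2268, 0, 0]` (Kubert–Tate `X₁(5)`-family; `rank E(ℚ) = 2` and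
`t₅(E) = 0` by the `μ₅`-descent, `KubertTate289ShaFive`). Its `2`-division field is the `S₃`-cubic `K = ℚ(γ)`,
`γ³ - γ² + 27γ + 36 = 0` (`disc = -14483`, `h_K = 1`, `CubicField14483*`). Over `K`, `E_K ≅ X = E_{A,B}` and the complete
`2`-isogeny descent `X ⇄ X'` inside the `K_v`-completions (`TwoIsogenyLocalImageNode*`, `AdicCompletionResidueHom`,
`AdicCompletionDyadicDepth`; `KubertTate289CubicLocalOdd/LocalTwo/SupportB/SupportBp/ShaPhi/ShaPhiHat/ShaTwo`) gives
`Ш(X/K)[2] = 0`, so `t₂(E ⊗ K) = 0`; and `t₂(E/ℚ) ≤ t₂(E ⊗ K/K)` (`ShaCorankBaseChange`). Hence, with NO `L`-function,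
`p`-adic or conjectural input, `t₂(E_{28/9}) = t₅(E_{28/9}) = 0` at rank `2`. This file records the reading for T:

* `transfer_five_two`, `transfer_two_five`, `transfer_of_mem` — T's instances at `(E_{28/9}; p, q ∈ {2, 5})` HOLD (the door
  row `rank = 2, t₂ = t₅ = 0, corank Sel_{2^∞} = corank Sel_{5^∞} = 2` is Literature `KubertTate289Descent.rankTwo_doors_two_five`);
* `cell_of_transfer` — the cell is T's instance by name; `shaCorank_eq_zero_of_transfer` — what T predicts beyond it.

T's further predictions `t_q(E_{28/9}) = 0`, `q ∉ {2, 5}`, stay predictions. No claim on BSD in rank ≥ 2.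

## References
* [SilvermanAEC2009] J. H. Silverman, *The Arithmetic of Elliptic Curves*, 2nd ed. (2009), Thm. X.4.2, Prop. X.4.9.
* [Darmon2004] H. Darmon, *Rational Points on Modular Elliptic Curves*, CBMS 101 (2004), §3.9, Exercise 3.18.
* [Greenberg1999LNM] R. Greenberg, *Iwasawa theory for elliptic curves*, LNM 1716 (1999), §1 (pp. 54–57).
-/

-- D-0017: single-problem summit, so `Summit.BirchSwinnertonDyer.BirchSwinnertonDyer.…` repeats a namespace BY DESIGN.
set_option linter.dupNamespace false

noncomputable section

open Literature.NumberTheory.EllipticCurves WeierstrassCurve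
open Summit.BirchSwinnertonDyer.BirchSwinnertonDyer.Theses.ShaPrimaryTransfer

namespace Summit.BirchSwinnertonDyer.BirchSwinnertonDyer.Theorems.ShaPrimaryTransferCubicDoor289

/-! ## §1 T's instances at `(E_{28/9}; 2, 5)` hold -/

/-- **The cell `(E_{28/9}, 5, 2)`: T's instance `t₅ = 0 → t₂ = 0` HOLDS** (both sides are theorems:
`KubertTate289Descent.shaCorank_five_eq_zero`, `KubertTate289Descent.shaCorank_two_eq_zero`).
[cite: SilvermanAEC2009, Thm. X.4.2(a)] [cite: Darmon2004, §3.9 and Exercise 3.18] -/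
theorem transfer_five_two :
    (kubertTateFive (((28 : ℤ) : ℚ)) (((9 : ℤ) : ℚ))).shaCorank 5 = 0 →
      (kubertTateFive (((28 : ℤ) : ℚ)) (((9 : ℤ) : ℚ))).shaCorank 2 = 0 :=
  fun _ => KubertTate289Descent.shaCorank_two_eq_zero

/-- **The cell `(E_{28/9}, 2, 5)`: T's instance `t₂ = 0 → t₅ = 0` HOLDS.** [cite: SilvermanAEC2009, Thm. X.4.2(a)] -/
theorem transfer_two_five :
    (kubertTateFive (((28 : ℤ) : ℚ)) (((9 : ℤ) : ℚ))).shaCorank 2 = 0 →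
      (kubertTateFive (((28 : ℤ) : ℚ)) (((9 : ℤ) : ℚ))).shaCorank 5 = 0 :=
  fun _ => KubertTate289Descent.shaCorank_five_eq_zero

/-- **T restricted to the primes `{2, 5}` holds on `E_{28/9}`** (all four instances, unconditionally).
[cite: SilvermanAEC2009, Thm. X.4.2(a)] -/
theorem transfer_of_mem {p q : ℕ} (_hp : p = 2 ∨ p = 5) (hq : q = 2 ∨ q = 5) :
    (kubertTateFive (((28 : ℤ) : ℚ)) (((9 : ℤ) : ℚ))).shaCorank p = 0 →
      (kubertTateFive (((28 : ℤ) : ℚ)) (((9 : ℤ) : ℚ))).shaCorank q = 0 := by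
  intro _
  rcases hq with rfl | rfl
  · exact KubertTate289Descent.shaCorank_two_eq_zero
  · exact KubertTate289Descent.shaCorank_five_eq_zero

/-! ## §2 Reading for T -/

/-- **The cell is an instance of T by name**: `FiniteShaComponentTransfer` specialised to `(E_{28/9}, 5, 2)` is the
implication `transfer_five_two` proves unconditionally (BSD is not proved; T is not proved).
[cite: SilvermanAEC2009, Thm. X.4.2(a)] -/
theorem cell_of_transfer (hT : FiniteShaComponentTransfer) :
    (kubertTateFive (((28 : ℤ) : ℚ)) (((9 : ℤ) : ℚ))).shaCorank 5 = 0 →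
      (kubertTateFive (((28 : ℤ) : ℚ)) (((9 : ℤ) : ℚ))).shaCorank 2 = 0 := by
  haveI := KubertTate289Descent.isElliptic
  haveI : Fact (Nat.Prime 5) := ⟨Nat.prime_five⟩
  exact hT _ 5 2

/-- **What T predicts beyond the cell**: granting T, every door of `E_{28/9}` is open (`t_q = 0` for all primes `q`),
from the proved `t₂ = 0`. [cite: Greenberg1999LNM, §1 (pp. 54–57)] -/
theorem shaCorank_eq_zero_of_transfer (hT : FiniteShaComponentTransfer) (q : ℕ) [Fact q.Prime] :
    (kubertTateFive (((28 : ℤ) : ℚ)) (((9 : ℤ) : ℚ))).shaCorank q = 0 := by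
  haveI := KubertTate289Descent.isElliptic
  exact hT _ 2 q KubertTate289Descent.shaCorank_two_eq_zero

end Summit.BirchSwinnertonDyer.BirchSwinnertonDyer.Theorems.ShaPrimaryTransferCubicDoor289

end
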